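import Summits.SmoothPoincare4.SmoothPoincare4.Theses.EntropyRung
import Summits.SmoothPoincare4.SmoothPoincare4.Theorems.EntropyRungCompactShrinkerGapScalarCurvaturePos
import Summits.SmoothPoincare4.SmoothPoincare4.Theorems.CompactShrinkerGap.Negative.WeylEnergyGurskyLeBrunDeficit
import HarnessLib

/-!
# Route EntropyRung — the glue item `CompactGapOfChangGurskyYang` from the crux, and from the variance budget

Item stmt-SmoothPoincare4-14743 is `CompactGapOfChangGurskyYang : ChangGurskyYang → CompactShrinkerGap`.
Its entire open content is the Weyl budget for dense normalised gradient shrinkers on closed homotopy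
4-spheres (`∫|W|² dV < 32π²`), the registered stub `stub_weylBudget` of the line `cgy-variance-pivot` of the
crux `CompactShrinkerGap` (stmt-SmoothPoincare4-10870); the reduction to that form is
`compactGapOfChangGurskyYang_of_weylBudget` (file `EntropyRungCompactGapOfChangGurskyYangReduction.lean`).

The crux line types the same open content in further registered strengths; this file records — sorry-free,
in the importable `Theorems` tree, attached to the item — that the item follows

* from the crux itself along any line: `compactGapOfChangGurskyYang_of_compactShrinkerGap`
  (`CompactShrinkerGap → CompactGapOfChangGurskyYang`, the CGY hypothesis unused);
* from the VARIANCE BUDGET `∫(R − 2)² dV < 2·Vol − 96π²` (hypothesis `hVB`, byte-for-byte the registered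
  `stub_varianceBudget`) and the Chern–Gauss–Bonnet formula taken as the named-fact hypothesis
  `hCGB : chernGaussBonnet_four`: `compactGapOfChangGurskyYang_of_varianceBudget`. Per datum the two budgets
  are equivalent (`weylBudget_iff_varianceBudget`, from the landed identity
  `∫|W|² = (D + 4V)/3 − 2(V − 32π²)`, `CompactShrinkerGap.Negative.weylEnergy_eq_third_sub`), and the
  Chang–Gursky–Yang door (`π₁(M ≃ₕ S⁴) = 1` proved, `R > 0` on a closed shrinker landed as
  `stub_scalarCurvaturePos_of_identities`, then `hCGY`) returns the diffeomorphism, exactly as in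
  `compactGapOfCGY_diffeomorph_of_weylEnergy_lt` of the reduction file.

The companion file `EntropyRungCompactGapOfChangGurskyYangCrzForm.lean` adds the third registered strength
(`stub_scalarLeThree`, `R ≤ 3`, via the landed Cheng–Ribeiro–Zhou sub-line). So the item closes in one line
from a proof of ANY of: the crux; `stub_weylBudget`; `stub_varianceBudget` + CGB; `stub_scalarLeThree` + CGB —
all four research-open (crux dossier `Cruxes/CompactShrinkerGap/NOTES.md`: no theorem in print bounds `∫|W|²`,
`∫(R − 2)²` or `sup R` of a compact 4-d shrinker by its Gaussian density).

References: S.-Y. A. Chang, M. J. Gursky, P. C. Yang, Publ. Math. IHÉS 98 (2003), Thm. A and (1.1)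
[ChangGurskyYang2003]; X. Cheng, E. Ribeiro, D. Zhou, arXiv:2203.14916, Thm. 1 and Lemma 1
[ChengRibeiroZhou2022]; H.-D. Cao, R. Hamilton, T. Ilmanen, arXiv:math/0404165, §4 [CaoHamiltonIlmanen2004].
-/

-- the registered namespace `Summit.SmoothPoincare4.SmoothPoincare4.Theorems` repeats a component
set_option linter.dupNamespace false

noncomputable section

open MeasureTheory Set
open scoped Manifold ContDiff ENNReal ContinuousMap

namespace Summit.SmoothPoincare4.SmoothPoincare4.Theorems

open Summit.SmoothPoincare4.SmoothPoincare4.Theses.EntropyRung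
open Literature.Geometry.Lorentzian (riemannianMeasure)

/-! ## The item from the crux along any line -/

/-- **`CompactGapOfChangGurskyYang` from `CompactShrinkerGap`**: the glue is an implication whose conclusion
is the crux, so any proof of the crux (along a Chang–Gursky–Yang-free line, e.g. `decay-climb-numax`) closes
the item with the CGY hypothesis unused. [folklore] -/
theorem compactGapOfChangGurskyYang_of_compactShrinkerGap (h : CompactShrinkerGap) :
    CompactGapOfChangGurskyYang :=
  fun _ ↦ h

/-! ## The item from the variance budget (registered `stub_varianceBudget`) and Chern–Gauss–Bonnet -/

/-- **Weyl budget ⟺ variance budget, per datum, given Chern–Gauss–Bonnet.** For a closed `M ≃ₕ S⁴` with a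
gradient shrinker `Ric + Hess f = g/2` (Riemannian `g` with Levi-Civita connection, smooth `f`):
`∫|W|² < 32π² ⟺ ∫(R − 2)² dV < 2·Vol − 96π²`, from `∫|W|² = (D + 4V)/3 − 2(V − 32π²)`
(`CompactShrinkerGap.Negative.weylEnergy_eq_third_sub`: CGB as the hypothesis `hCGB`, `χ = 2`, the landed
`∫σ₂ = V/6 − D/12`) and finiteness of the Weyl energy on the closed manifold (`weylEnergy_lt_top`).
[cite: ChangGurskyYang2003, Thm. A and (1.1)] -/
theorem weylBudget_iff_varianceBudget (hCGB : Literature.Geometry.Riemannian.chernGaussBonnet_four)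
    (M : Type) [TopologicalSpace M] [T2Space M] [SecondCountableTopology M]
    [ChartedSpace (EuclideanSpace ℝ (Fin 4)) M] [IsManifold (𝓡 4) ∞ M] [CompactSpace M]
    [T3Space M] [MeasurableSpace M] [BorelSpace M]
    (e : M ≃ₕ Metric.sphere (0 : EuclideanSpace ℝ (Fin 5)) 1)
    (g : Literature.Geometry.Lorentzian.PseudoRiemannianMetric (𝓡 4) ∞ (EuclideanSpace ℝ (Fin 4))
      (TangentSpace (𝓡 4) : M → Type _)) [g.HasLeviCivita] (f : M → ℝ) (hg : g.IsRiemannian)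
    (hf : ContMDiff (𝓡 4) 𝓘(ℝ, ℝ) ∞ f)
    (hsol : ∀ (x : M) (X Y : TangentSpace (𝓡 4) x),
      g.ricci x X Y + g.hessian f x X Y = (1 / 2 : ℝ) * g.val x X Y) :
    g.weylEnergy < ENNReal.ofReal (32 * Real.pi ^ 2) ↔
      ∫ x, (g.scalarCurvature x - 2) ^ 2 ∂(riemannianMeasure (g.toContMDiffRiemannianMetric hg)) <
        2 * ((riemannianMeasure (g.toContMDiffRiemannianMetric hg)) Set.univ).toReal -
          96 * Real.pi ^ 2 := by
  rw [ENNReal.lt_ofReal_iff_toReal_lt (g.weylEnergy_lt_top hg).ne,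
    Summit.SmoothPoincare4.SmoothPoincare4.Theorems.CompactShrinkerGap.Negative.weylEnergy_eq_third_sub
      hCGB M e g f hg hf hsol]
  constructor <;> intro h <;> linarith

/-- **Item `CompactGapOfChangGurskyYang` from the variance budget and Chern–Gauss–Bonnet.** If every dense
normalised gradient shrinker on a closed homotopy 4-sphere has `∫(R − 2)² dV < 2·Vol − 96π²` (hypothesis
`hVB`, verbatim the registered stub `stub_varianceBudget` of line `cgy-variance-pivot` of crux
stmt-SmoothPoincare4-10870), then — given the CGB formula `hCGB` — `ChangGurskyYang → CompactShrinkerGap`: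
the variance budget is the Weyl budget (`weylBudget_iff_varianceBudget`), `π₁(M) = 1`
(`simplyConnectedSpace_of_homotopyEquiv_sphere_four`), `R > 0` on the closed shrinker
(`stub_scalarCurvaturePos_of_identities` with (B) from `stub_shrinkerScalarIdentities`), and `hCGY`
(Chang–Gursky–Yang 2003 Thm. A) returns `M ≃ₘ S⁴`. [cite: ChangGurskyYang2003, Thm. A and (1.1)] -/
theorem compactGapOfChangGurskyYang_of_varianceBudget
    (hCGB : Literature.Geometry.Riemannian.chernGaussBonnet_four)
    (hVB : ∀ (M : Type) [TopologicalSpace M] [T2Space M] [SecondCountableTopology M]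
      [ChartedSpace (EuclideanSpace ℝ (Fin 4)) M] [IsManifold (𝓡 4) ∞ M] [CompactSpace M]
      [T3Space M] [MeasurableSpace M] [BorelSpace M],
      M ≃ₕ Metric.sphere (0 : EuclideanSpace ℝ (Fin 5)) 1 →
    ∀ (g : Literature.Geometry.Lorentzian.PseudoRiemannianMetric (𝓡 4) ∞ (EuclideanSpace ℝ (Fin 4))
        (TangentSpace (𝓡 4) : M → Type _)) [g.HasLeviCivita] (f : M → ℝ) (hg : g.IsRiemannian),
      ContMDiff (𝓡 4) 𝓘(ℝ, ℝ) ∞ f →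
      (∀ (x : M) (X Y : TangentSpace (𝓡 4) x),
        g.ricci x X Y + g.hessian f x X Y = (1 / 2 : ℝ) * g.val x X Y) →
      (∀ x : M, g.scalarCurvature x + g.gradSq f x = f x) →
      ENNReal.ofReal (32 * Real.pi ^ 2 * Real.sqrt Real.pi * Real.exp (-(3 : ℝ) / 2)) <
        ∫⁻ x, ENNReal.ofReal (Real.exp (-f x))
          ∂(Literature.Geometry.Lorentzian.riemannianMeasure (g.toContMDiffRiemannianMetric hg)) →
      ∫ x, (g.scalarCurvature x - 2) ^ 2
          ∂(Literature.Geometry.Lorentzian.riemannianMeasure (g.toContMDiffRiemannianMetric hg)) <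
        2 * ((Literature.Geometry.Lorentzian.riemannianMeasure (g.toContMDiffRiemannianMetric hg))
              Set.univ).toReal - 96 * Real.pi ^ 2) :
    CompactGapOfChangGurskyYang := by
  unfold CompactGapOfChangGurskyYang CompactShrinkerGap
  intro hCGY M _ _ _ _ _ _ _ _ _ e g _ f hg hf hsol hnorm hdens
  -- the Weyl budget from the variance budget (CGB, `χ = 2`)
  have hW : g.weylEnergy < ENNReal.ofReal (32 * Real.pi ^ 2) :=
    (weylBudget_iff_varianceBudget hCGB M e g f hg hf hsol).2 (hVB M e g f hg hf hsol hnorm hdens)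
  -- the Chang–Gursky–Yang door: `π₁ = 1`, `R > 0`, `∫|W|² < 32π²`
  haveI : SimplyConnectedSpace M :=
    Literature.Topology.FourManifolds.simplyConnectedSpace_of_homotopyEquiv_sphere_four
      Literature.Topology.FourManifolds.simplyConnectedSpace_sphere_four_holds M e
  obtain ⟨_, hB⟩ := stub_shrinkerScalarIdentities M g f hg hf hsol
  have hR : ∀ x : M, 0 < g.scalarCurvature x :=
    stub_scalarCurvaturePos_of_identities M g f hg hf hsol hB
  exact hCGY M ⟨g, ‹_›, hg, hR, hW⟩

end Summit.SmoothPoincare4.SmoothPoincare4.Theorems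

end
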